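import Literature.Barriers.CriticalPhenomena.SupercriticalSAWSpaceFillingEstimates
import Literature.Probability.RandomPlanarGeometry.SAWLists
import HarnessLib

/-!
# Supercritical SAW (Duminil-Copin–Kozma–Yadin 2014), Theorem 6 for the disk via odd tiles:
# from weighted sums over vertex lists to the law `P_{(𝔻_δ, a_δ, b_δ, x)}`

Bridge between the measures `weightAt x`, `lawAt x` of
`SupercriticalSAWSpaceFilling.lean` (on `DomainSAW 𝔻 δ u v`, walks of the graph `𝔻_δ`) and the
list form of self-avoiding walks of `Literature/Probability/RandomPlanarGeometry/SAWLists.lean`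
(`domSawLists (zdGraph 2) D u v`, `listPartition`), in which the energy–entropy surgery of
the proof of Theorem 6 of H. Duminil-Copin, G. Kozma, A. Yadin, *Supercritical self-avoiding
walks are space-filling*, Ann. IHP Probab. Stat. 50 (2014) is carried out:

* `Dfin δ` — the sites of `𝔻_δ` as a `Finset`; `support_mem_domSawLists_Dfin` — the support of a
  SAW of `𝔻_δ` from `u ∈ 𝔻_δ` is a member of `domSawLists (zdGraph 2) (Dfin δ) u v`, and
  conversely `sawOfList` turns such a member into a SAW of `𝔻_δ` with that support; hence
  `DomainSAW 𝔻 δ u v` is finite (`finite_domainSAW`).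
* `weightAt_le_ofReal_sum` — `weight(E) ≤ Σ_{l ∈ EL} x^{|l|-1}` whenever the supports of the walks
  of `E` lie in the finite list set `EL` (supports are injective, `|γ| = |support γ| - 1`);
  `ofReal_listPartition_le_weightAt_univ` — `Z_list ≤ Z`.
* `lawAt_le_of_list_bound` — **the transfer**: `Σ_{l ∈ EL} x^{|l|-1} ≤ B · Z_list` gives
  `P(E) ≤ B` (`lawAt_le_of_weightAt_le`).
-/

noncomputable section

open MeasureTheory Finset Literature.Probability.LatticeModels Literature.Probability.Percolation
  Literature.Probability.RandomPlanarGeometry.SAW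
open scoped ENNReal

namespace Literature.Barriers.CriticalPhenomena

namespace SupercriticalSAW

variable {δ : ℝ} {u v : Site 2}

/-! ### The disk as a finite set -/

open Classical in
/-- The sites of `𝔻_δ` as a finite set (inside the box `{-⌈1/δ⌉, …, ⌈1/δ⌉}²`). [folklore] -/
def Dfin (δ : ℝ) : Finset (Site 2) := (box 2 ⌈1 / δ⌉₊).filter fun w => w ∈ meshDomain unitDisk δ

/-- Membership in `Dfin`. [folklore] -/
theorem mem_Dfin (hδ : 0 < δ) {w : Site 2} : w ∈ Dfin δ ↔ w ∈ meshDomain unitDisk δ := by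
  classical
  rw [Dfin, Finset.mem_filter, and_iff_right_iff_imp]
  intro h
  rw [mem_box]
  intro i
  have habs := abs_lt_of_mem_meshDomain_unitDisk hδ h i
  have hlt : |((w i : ℤ) : ℝ)| < ((⌈1 / δ⌉₊ : ℕ) : ℝ) := habs.trans_le (Nat.le_ceil _)
  have hlt' : |w i| < (⌈1 / δ⌉₊ : ℤ) := by exact_mod_cast hlt
  constructor <;> linarith [abs_lt.1 hlt']

/-! ### Walks of `𝔻_δ` and vertex lists -/

/-- The vertices of a walk of `𝔻_δ` from a site of `𝔻_δ` lie in `𝔻_δ`. [folklore] -/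
theorem support_subset_meshDomain (p : (discreteDomainGraph unitDisk δ).Walk u v)
    (hu : u ∈ meshDomain unitDisk δ) : ∀ w ∈ p.support, w ∈ meshDomain unitDisk δ := by
  induction p with
  | nil => intro w hw; rw [SimpleGraph.Walk.support_nil, List.mem_singleton] at hw; exact hw ▸ hu
  | cons h p ih =>
    intro w hw
    rw [SimpleGraph.Walk.support_cons, List.mem_cons] at hw
    rcases hw with rfl | hw
    · exact hu
    · exact ih (discreteDomainGraph_unitDisk_adj.1 h).2.2 w hw

/-- **The support of a SAW of `𝔻_δ` is a member of the list form.** [folklore] -/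
theorem support_mem_domSawLists_Dfin (hδ : 0 < δ) (hu : u ∈ meshDomain unitDisk δ)
    (γ : DomainSAW unitDisk δ u v) : γ.walk.support ∈ domSawLists (zdGraph 2) (Dfin δ) u v := by
  classical
  have hD := support_subset_meshDomain γ.walk hu
  rw [mem_domSawLists]
  refine ⟨⟨γ.walk.support_ne_nil, ?_, γ.isPath.support_nodup, fun w hw => (mem_Dfin hδ).2 (hD w hw)⟩, ?_, ?_⟩
  · exact γ.walk.isChain_adj_support.imp fun _ _ h => (discreteDomainGraph_unitDisk_adj.1 h).1
  · rw [List.head?_eq_some_head γ.walk.support_ne_nil, γ.walk.head_support]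
  · rw [List.getLast?_eq_some_getLast γ.walk.support_ne_nil, γ.walk.getLast_support]

/-- **A member of the list form is the support of a SAW of `𝔻_δ`.** [folklore] -/
def sawOfList (hδ : 0 < δ) {l : List (Site 2)} (hl : l ∈ domSawLists (zdGraph 2) (Dfin δ) u v) :
    DomainSAW unitDisk δ u v := by
  classical
  have hsaw := (mem_domSawLists.1 hl).1
  have hchain : l.IsChain (discreteDomainGraph unitDisk δ).Adj := by
    have hc := hsaw.isChain
    have hD := hsaw.subset
    clear hl
    induction l with
    | nil => exact List.IsChain.nil
    | cons a t ih =>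
      cases t with
      | nil => exact List.isChain_singleton a
      | cons b t' =>
        rw [List.isChain_cons_cons] at hc ⊢
        refine ⟨discreteDomainGraph_unitDisk_adj.2 ⟨hc.1, (mem_Dfin hδ).1 (hD a (by simp)),
          (mem_Dfin hδ).1 (hD b (by simp))⟩, ih ?_ hc.2 fun w hw => hD w (List.mem_cons_of_mem _ hw)⟩
        exact ⟨by simp, hc.2, (List.nodup_cons.1 hsaw.nodup).2, fun w hw => hD w (List.mem_cons_of_mem _ hw)⟩
  exact ⟨((SimpleGraph.Walk.ofSupport l hsaw.ne_nil hchain).copy (head_eq_of_mem_domSawLists hl _)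
      (getLast_eq_of_mem_domSawLists hl _)), by
    rw [SimpleGraph.Walk.isPath_def, SimpleGraph.Walk.support_copy, SimpleGraph.Walk.support_ofSupport]
    exact hsaw.nodup⟩

/-- The SAW of a list has that list as support. [folklore] -/
theorem support_sawOfList (hδ : 0 < δ) {l : List (Site 2)} (hl : l ∈ domSawLists (zdGraph 2) (Dfin δ) u v) :
    (sawOfList hδ hl).walk.support = l := by
  simp [sawOfList, SimpleGraph.Walk.support_copy, SimpleGraph.Walk.support_ofSupport]

/-- The support map on SAWs of `𝔻_δ` is injective. [folklore] -/
theorem support_injective_domainSAW : Function.Injective fun γ : DomainSAW unitDisk δ u v => γ.walk.support := by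
  rintro ⟨p, hp⟩ ⟨q, hq⟩ h
  simp only at h
  have := SimpleGraph.Walk.support_injective h
  subst this
  rfl

/-- **`DomainSAW 𝔻 δ u v` is finite** (for `δ > 0` and `u ∈ 𝔻_δ`). [folklore] -/
theorem finite_domainSAW (hδ : 0 < δ) (hu : u ∈ meshDomain unitDisk δ) : Finite (DomainSAW unitDisk δ u v) := by
  classical
  refine Finite.of_injective (fun γ : DomainSAW unitDisk δ u v =>
    (⟨γ.walk.support, support_mem_domSawLists_Dfin hδ hu γ⟩ : ↥(domSawLists (zdGraph 2) (Dfin δ) u v))) ?_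
  intro γ γ' h
  exact support_injective_domainSAW (congrArg Subtype.val h)

/-! ### Weights as finite sums -/

/-- The weight of a set of SAWs as a sum over the (finite) type of SAWs. [folklore] -/
theorem weightAt_apply_eq_sum (x : ℝ) [Fintype (DomainSAW unitDisk δ u v)] (E : Set (DomainSAW unitDisk δ u v))
    [DecidablePred (· ∈ E)] :
    weightAt x unitDisk δ u v E = ∑ γ ∈ Finset.univ.filter (· ∈ E), ENNReal.ofReal (x ^ γ.length) := by
  rw [weightAt, Measure.sum_apply _ MeasurableSpace.measurableSet_top, tsum_fintype, Finset.sum_filter]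
  refine Finset.sum_congr rfl fun γ _ => ?_
  rw [Measure.smul_apply, Measure.dirac_apply' _ MeasurableSpace.measurableSet_top, smul_eq_mul]
  by_cases h : γ ∈ E
  · rw [Set.indicator_of_mem h, Pi.one_apply, mul_one, if_pos h]
  · rw [Set.indicator_of_notMem h, mul_zero, if_neg h]

/-- **Weights are bounded by list sums**: if the supports of the walks of `E` lie in the finite
list set `EL`, then `weight(E) ≤ Σ_{l ∈ EL} x^{|l|-1}` (`x ≥ 0`). [folklore] -/
theorem weightAt_le_ofReal_sum (hδ : 0 < δ) (hu : u ∈ meshDomain unitDisk δ) {x : ℝ} (hx : 0 ≤ x)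
    (E : Set (DomainSAW unitDisk δ u v)) (EL : Finset (List (Site 2)))
    (hE : ∀ γ ∈ E, γ.walk.support ∈ EL) :
    weightAt x unitDisk δ u v E ≤ ENNReal.ofReal (∑ l ∈ EL, x ^ (l.length - 1)) := by
  classical
  haveI := finite_domainSAW (v := v) hδ hu
  haveI : Fintype (DomainSAW unitDisk δ u v) := Fintype.ofFinite _
  rw [weightAt_apply_eq_sum, ← ENNReal.ofReal_sum_of_nonneg fun γ _ => pow_nonneg hx _]
  refine ENNReal.ofReal_le_ofReal ?_
  set F := (Finset.univ : Finset (DomainSAW unitDisk δ u v)).filter (· ∈ E) with hF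
  have hinj : Set.InjOn (fun γ : DomainSAW unitDisk δ u v => γ.walk.support) F :=
    fun γ _ γ' _ h => support_injective_domainSAW h
  calc ∑ γ ∈ F, x ^ γ.length = ∑ γ ∈ F, x ^ (γ.walk.support.length - 1) := by
        refine Finset.sum_congr rfl fun γ _ => ?_
        rw [SimpleGraph.Walk.length_support]; rfl
    _ = ∑ l ∈ F.image fun γ => γ.walk.support, x ^ (l.length - 1) := by rw [Finset.sum_image hinj]
    _ ≤ ∑ l ∈ EL, x ^ (l.length - 1) := by
        refine Finset.sum_le_sum_of_subset_of_nonneg (fun l hl => ?_) fun l _ _ => pow_nonneg hx _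
        obtain ⟨γ, hγ, rfl⟩ := Finset.mem_image.1 hl
        exact hE γ (Finset.mem_filter.1 hγ).2

/-- **The list partition function is at most the partition function `Z`.** [folklore] -/
theorem ofReal_listPartition_le_weightAt_univ (hδ : 0 < δ) (hu : u ∈ meshDomain unitDisk δ) {x : ℝ} (hx : 0 ≤ x) :
    ENNReal.ofReal (listPartition (zdGraph 2) (Dfin δ) u v x) ≤ weightAt x unitDisk δ u v Set.univ := by
  classical
  haveI := finite_domainSAW (v := v) hδ hu
  haveI : Fintype (DomainSAW unitDisk δ u v) := Fintype.ofFinite _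
  rw [weightAt_apply_eq_sum, ← ENNReal.ofReal_sum_of_nonneg fun γ _ => pow_nonneg hx _]
  refine ENNReal.ofReal_le_ofReal ?_
  rw [listPartition]
  set DL := domSawLists (zdGraph 2) (Dfin δ) u v with hDL
  -- the SAW of a list, as an injection into the type of SAWs
  let Ψ : ↥DL → DomainSAW unitDisk δ u v := fun l => sawOfList hδ l.2
  have hsupp : ∀ l : ↥DL, (Ψ l).walk.support = l.1 := fun l => support_sawOfList hδ l.2
  have hΨinj : Function.Injective Ψ := fun l l' h => by
    apply Subtype.ext
    rw [← hsupp l, ← hsupp l', h]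
  have hlen : ∀ l : ↥DL, (l.1).length - 1 = (Ψ l).length := fun l => by
    have := (Ψ l).walk.length_support
    rw [hsupp l] at this
    show (l.1).length - 1 = (Ψ l).walk.length
    omega
  calc ∑ l ∈ DL, x ^ (l.length - 1) = ∑ l ∈ DL.attach, x ^ ((l.1).length - 1) := (Finset.sum_attach _ _).symm
    _ = ∑ l ∈ DL.attach, x ^ (Ψ l).length := Finset.sum_congr rfl fun l _ => by rw [hlen l]
    _ = ∑ γ ∈ DL.attach.image Ψ, x ^ γ.length := by
        rw [Finset.sum_image fun l _ l' _ h => hΨinj h]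
    _ ≤ ∑ γ ∈ Finset.univ.filter (· ∈ (Set.univ : Set (DomainSAW unitDisk δ u v))), x ^ γ.length := by
        refine Finset.sum_le_sum_of_subset_of_nonneg (fun γ _ => by simp) fun γ _ _ => pow_nonneg hx _

/-- **The transfer to the law.** If the supports of the walks of `E` lie in `EL` and
`Σ_{l ∈ EL} x^{|l|-1} ≤ B · Z_list` with `B ≥ 0`, then `P_{(𝔻_δ,u,v,x)}(E) ≤ B`.
[cite: DuminilCopinKozmaYadin2014, §1 (definition of P_{(Ω_δ,a_δ,b_δ,x)})] -/
theorem lawAt_le_of_list_bound (hδ : 0 < δ) (hu : u ∈ meshDomain unitDisk δ) {x : ℝ} (hx : 0 ≤ x)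
    {E : Set (DomainSAW unitDisk δ u v)} {EL : Finset (List (Site 2))} (hE : ∀ γ ∈ E, γ.walk.support ∈ EL)
    {B : ℝ} (hB : 0 ≤ B)
    (hbound : ∑ l ∈ EL, x ^ (l.length - 1) ≤ B * listPartition (zdGraph 2) (Dfin δ) u v x) :
    lawAt x unitDisk δ u v E ≤ ENNReal.ofReal B := by
  apply lawAt_le_of_weightAt_le
  calc weightAt x unitDisk δ u v E ≤ ENNReal.ofReal (∑ l ∈ EL, x ^ (l.length - 1)) :=
        weightAt_le_ofReal_sum hδ hu hx E EL hE
    _ ≤ ENNReal.ofReal (B * listPartition (zdGraph 2) (Dfin δ) u v x) := ENNReal.ofReal_le_ofReal hbound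
    _ = ENNReal.ofReal B * ENNReal.ofReal (listPartition (zdGraph 2) (Dfin δ) u v x) := ENNReal.ofReal_mul hB
    _ ≤ ENNReal.ofReal B * weightAt x unitDisk δ u v Set.univ :=
        mul_le_mul' le_rfl (ofReal_listPartition_le_weightAt_univ hδ hu hx)

end SupercriticalSAW

end Literature.Barriers.CriticalPhenomena
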